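import Mathlib
import Summits.ValiantsHypothesis.ValiantsHypothesis.Theorems.FifoMatchingNNLinearDegreeCofactorHardShedWordParams
import HarnessLib

/-!
# Crux `NNLinearDegreeCofactorHard` (stmt-ValiantsHypothesis-23918), line `internal_cofactor`, stub S2b (ii):
# μ* = shedWord — PARAMETERS AT THE INTERFACE DENSITY `a = 28` (pure arithmetic)

`…ShedWordParams` (`fit`, `rate_of_heart`) fixes the trace density at `1012 · #R′ ≤ N + 4` (density constant `a = 1024`) and
uses the free-mass deficit of `ShedWord.heart_popped` (`N/6 − 2#R′ − (N − E) − H − 2F₀ − 6w`).  This file re-proves the two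
density-dependent inequalities at the MINIMUM density the interface `InternalCofactor.avoidingCounts_of_pricing a (ha : 28 ≤ a)`
admits — `16 · #R′ ≤ N + 4`, which follows from `(a − 12) · #R ≤ N + 4` for every `a ≥ 28` — using instead the deficit of
`ShedWord.heart_popped_tight` (`N/6 − #R′ − (N − E)/2 − H − 2F₀ − 6w`, p3), with the same parameters `g = root16 N ≥ 4096`,
`H = g¹²`, `w = g¹¹`, `E = N − 2(#R′ + H + w)` (so `(N − E)/2 = #R′ + H + w`) and the same rate `g / 32`:

* `fit_sixteen` — `3 g¹² + 2 g¹¹ + 2 #R′ ≤ N`;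
* `deficit_tight_ge` — the tight deficit is at least `g¹⁶ / 48` (in particular it is not the truncated `0`);
* `rate_of_heart_tight` — the tight heart's dichotomy gives `2 (g/32) + 5 ≤ tests + P′`.

Honest framing: arithmetic only; nothing here proves S2b, the crux or VP ≠ VNP (not proved).  No definitions. [folklore]
-/

-- Sub = Summit single-conjunct layout: the duplicated namespace component is mandated by the tree.
set_option linter.dupNamespace false

namespace Summit.ValiantsHypothesis.ValiantsHypothesis.Theorems.FifoMatching.NNLinearDegreeCofactorHard.ShedWord

/-- **Everything fits at density `1/16`**: `3 g¹² + 2 g¹¹ + 2 #R′ ≤ N` for `g = root16 N ≥ 4096` and `16 #R′ ≤ N + 4`.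
[folklore] -/
theorem fit_sixteen {N Rc : ℕ} (hg : 4096 ≤ root16 N) (hRc : 16 * Rc ≤ N + 4) :
    3 * root16 N ^ 12 + 2 * root16 N ^ 11 + 2 * Rc ≤ N := by
  set g := root16 N with hgdef
  have hN : g ^ 16 ≤ N := root16_pow_le N
  have h1 : g ^ 16 = g ^ 4 * g ^ 12 := by ring
  have h4 : 4096 ^ 4 ≤ g ^ 4 := Nat.pow_le_pow_left hg 4
  have h2 : g ^ 11 ≤ g ^ 12 := Nat.pow_le_pow_right (by omega) (by norm_num)
  have h5 : 1 ≤ g ^ 12 := Nat.one_le_pow _ _ (by omega)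
  have h3 : 64 * g ^ 12 ≤ g ^ 16 := by
    rw [h1]
    exact Nat.mul_le_mul_right _ (le_trans (by norm_num) h4)
  omega

/-- **The tight deficit is large**: with `16 #R′ ≤ N + 4`, `F₀ ≤ g¹²`, `g = root16 N ≥ 4096`,
`g¹⁶ / 48 ≤ N/6 − #R′ − (#R′ + g¹² + g¹¹) − g¹² − 2F₀ − 6 g¹¹`. [folklore] -/
theorem deficit_tight_ge {N Rc F₀ : ℕ} (hg : 4096 ≤ root16 N) (hRc : 16 * Rc ≤ N + 4) (hF₀u : F₀ ≤ root16 N ^ 12) :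
    root16 N ^ 16 / 48 ≤
      N / 6 - Rc - (Rc + root16 N ^ 12 + root16 N ^ 11) - root16 N ^ 12 - 2 * F₀ - 6 * root16 N ^ 11 := by
  set g := root16 N with hgdef
  have hN : g ^ 16 ≤ N := root16_pow_le N
  have e16 : g ^ 16 = g ^ 4 * g ^ 12 := by ring
  have h4 : 4096 ^ 4 ≤ g ^ 4 := Nat.pow_le_pow_left hg 4
  have h1112 : g ^ 11 ≤ g ^ 12 := Nat.pow_le_pow_right (by omega) (by norm_num)
  have h5 : 1 ≤ g ^ 12 := Nat.one_le_pow _ _ (by omega)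
  have hbig : 2 ^ 48 * g ^ 12 ≤ g ^ 16 := by
    rw [e16]; exact Nat.mul_le_mul_right _ (le_trans (by norm_num) h4)
  omega

/-- **The rate from the TIGHT heart at density `1/16`.**  With `H = g¹²`, `w = g¹¹`, `3H ≤ 4F₀`, `F₀ ≤ H`, `16 #R′ ≤ N + 4`,
`g = root16 N ≥ 4096`, the dichotomy of `ShedWord.heart_popped_tight` at `E = N − 2(#R′ + H + w)` (tight free-mass deficit
`≤ (F₀ + w) P′`, or `F₀ − w ≤ tests + 2w(2P′ + 1)`) gives `2 (g/32) + 5 ≤ tests + P′`. [folklore] -/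
theorem rate_of_heart_tight {N Rc F₀ P T : ℕ} (hg : 4096 ≤ root16 N) (hRc : 16 * Rc ≤ N + 4)
    (hF₀l : 3 * root16 N ^ 12 ≤ 4 * F₀) (hF₀u : F₀ ≤ root16 N ^ 12)
    (hheart : N / 6 - Rc - (Rc + root16 N ^ 12 + root16 N ^ 11) - root16 N ^ 12 - 2 * F₀ - 6 * root16 N ^ 11 ≤
        (F₀ + root16 N ^ 11) * P ∨
      F₀ - root16 N ^ 11 ≤ T + 2 * root16 N ^ 11 * (2 * P + 1)) :
    2 * (root16 N / 32) + 5 ≤ T + P := by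
  have hdef0 := deficit_tight_ge (N := N) hg hRc hF₀u
  set g := root16 N with hgdef
  have hN : g ^ 16 ≤ N := root16_pow_le N
  have e16 : g ^ 16 = g ^ 4 * g ^ 12 := by ring
  have e12 : g ^ 12 = g * g ^ 11 := by ring
  have h4 : 4096 ^ 4 ≤ g ^ 4 := Nat.pow_le_pow_left hg 4
  have hg11 : 0 < g ^ 11 := Nat.pow_pos (by omega)
  have hg12 : 0 < g ^ 12 := Nat.pow_pos (by omega)
  have h1112 : g ^ 11 ≤ g ^ 12 := Nat.pow_le_pow_right (by omega) (by norm_num)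
  rcases hheart with h | h
  · -- Case 1: the tight deficit is at least `g^16 / 48`, and `F₀ + w ≤ 2 g^12`
    have hdef : g ^ 16 / 48 ≤ (F₀ + g ^ 11) * P := le_trans hdef0 h
    have hP : g ^ 4 / 96 ≤ P := by
      by_contra hlt
      rw [not_le] at hlt
      have : (F₀ + g ^ 11) * P < g ^ 16 / 48 := by
        calc (F₀ + g ^ 11) * P ≤ (2 * g ^ 12) * P := Nat.mul_le_mul_right _ (by omega)
          _ < (2 * g ^ 12) * (g ^ 4 / 96) := Nat.mul_lt_mul_of_pos_left hlt (by omega)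
          _ ≤ g ^ 16 / 48 := by
            rw [e16, Nat.le_div_iff_mul_le (by norm_num)]
            have := Nat.div_mul_le_self (g ^ 4) 96
            nlinarith
      omega
    have hg4 : 96 * (g / 16 + 5) ≤ g ^ 4 := by
      have e4 : g ^ 4 = g * g * g * g := by ring
      have hA : 96 * (g / 16 + 5) ≤ 6 * g + 480 := by omega
      have hB : 6 * g + 480 ≤ g * g := by nlinarith
      have hC : g * g ≤ g * g * g * g := by
        calc g * g = g * g * 1 * 1 := by ring
          _ ≤ g * g * g * g := by gcongr <;> omega
      rw [e4]; omega
    have : g / 16 + 5 ≤ g ^ 4 / 96 := by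
      rw [Nat.le_div_iff_mul_le (by norm_num)]
      nlinarith
    omega
  · -- Case 2: `4 w (T + P) ≥ 3H/4 − 3w ≥ w · (g / 2)` (density-free; as in `rate_of_heart`)
    have h2 : F₀ ≤ T + 4 * g ^ 11 * P + 3 * g ^ 11 := by
      have : 2 * g ^ 11 * (2 * P + 1) = 4 * g ^ 11 * P + 2 * g ^ 11 := by ring
      omega
    have h3 : 3 * g ^ 12 ≤ 4 * g ^ 11 * T + 16 * g ^ 11 * P + 12 * g ^ 11 := by
      have hT : T ≤ g ^ 11 * T := Nat.le_mul_of_pos_left T hg11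
      nlinarith
    have h4' : g ^ 11 * (3 * g) ≤ g ^ 11 * (4 * T + 16 * P + 12) := by
      have : g ^ 11 * (3 * g) = 3 * g ^ 12 := by rw [e12]; ring
      rw [this]
      calc 3 * g ^ 12 ≤ 4 * g ^ 11 * T + 16 * g ^ 11 * P + 12 * g ^ 11 := h3
        _ = g ^ 11 * (4 * T + 16 * P + 12) := by ring
    have h5 : 3 * g ≤ 4 * T + 16 * P + 12 := Nat.le_of_mul_le_mul_left h4' hg11
    omega

/-- **Density bookkeeping**: `a · #R ≤ 2n`, `2n ≤ N + 12 · #R + 4`, `28 ≤ a` and `#R′ ≤ #R` give `16 · #R′ ≤ N + 4`. [folklore] -/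
theorem sixteen_mul_le {a n N Rc Rc' : ℕ} (ha : 28 ≤ a) (hR : a * Rc ≤ 2 * n) (hN : 2 * n ≤ N + 12 * Rc + 4)
    (hRc' : Rc' ≤ Rc) : 16 * Rc' ≤ N + 4 := by
  have h1 : 28 * Rc ≤ a * Rc := Nat.mul_le_mul_right Rc ha
  omega

end Summit.ValiantsHypothesis.ValiantsHypothesis.Theorems.FifoMatching.NNLinearDegreeCofactorHard.ShedWord
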